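import Summits.FinalStateConjecture.FinalStateConjecture.Theorems.EIHFluxBalanceModulatedKerrHandoffOneHoleTameDelta
import Summits.FinalStateConjecture.FinalStateConjecture.Theorems.EIHFluxBalanceModulatedKerrHandoffOneHoleTameArith
import Summits.FinalStateConjecture.FinalStateConjecture.Theorems.EIHFluxBalanceModulatedKerrHandoffOneHoleSetup

/-!
# Route EIHFluxBalance — `ModulatedKerrHandoff`, stub `stub_oneHoleMatching`: the tame-regime bound

Helper file for the crux `stmt-FinalStateConjecture-10167`
(`Summit.FinalStateConjecture.FinalStateConjecture.Theses.EIHFluxBalance.ModulatedKerrHandoff`),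
line `photon-rocket-modulation`, stub `stub_oneHoleMatching` (one-hole profile matching).

`tame_pointwise`: there are `K ≥ 0` and `T > 0` such that at every lab point `x` with `x⁰ = t ≥ T`,
retarded time `U x ≥ (1 − κ) t / 2`, lab distance `d ≤ 2t` and instantaneous Kerr–Schild radius
`ρ x > rin`, the retarded rest-frame Kerr–Schild radius is positive (conclusion (O2) of the stub) and
the DIFFERENCE of the retarded and instantaneous summands satisfies, for `m ≤ 3`,
`‖Dᵐ(ret − inst)(x)‖ ≤ K (max 1 d)⁻¹ (1/t + 1/((1 − κ)t/2)^{3/4+σ})`. Assembly: `ret − inst =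
ε • (𝔉 ∘ p₁ − 𝔉 ∘ p₀)` (`OneHole.boostedKerrBilin_sub_eq_smul_kernel`); the segment `[p₀ x, p₁ x]` lies
in a compact parameter box (`OneHole.exists_box_segment`, relative smallness of the position defect by
`OneHole.tame_relative`); the difference lemma `OneHole.exists_norm_iteratedFDeriv_comp_sub_comp_le` with
the uniform sizes `OneHole.tame_ck₁_ret/inst` and the smallness `OneHole.tame_ck_delta`, whose rate is
`OneHole.tame_rates` and the monopole mass rate.
-/

noncomputable section

-- `Summit.<S>.<S>.…` (single-problem summit, D-0017) trips core's duplicate-namespace linter.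
set_option linter.dupNamespace false

open Set Filter Function Literature.Geometry.Lorentzian
open scoped Topology ContDiff

namespace Summit.FinalStateConjecture.FinalStateConjecture.Theorems

namespace OneHole

/-- **The parameter segment lies in the box** once its endpoints' masses, boosts, spin are in range and
the scaled positions along it are (`OneHole.exists_box_segment`). [folklore] -/
theorem segment_subset_box {m₀ m₁ a ε : ℝ} {L₀ L₁ : E4 →L[ℝ] E4} {Y₀ Y₁ : E3} {Mb Lb ab Rb rb : ℝ}
    (hm₀ : |m₀| ≤ Mb) (hm₁ : |m₁| ≤ Mb) (hL₀ : ‖L₀‖ ≤ Lb) (hL₁ : ‖L₁‖ ≤ Lb) (ha : |ε * a| ≤ ab)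
    (hw : ∀ s ∈ Icc (0 : ℝ) 1, ‖ε • (Y₀ + s • (Y₁ - Y₀))‖ ≤ Rb ∧
      rb ≤ Kerr.radius (ε * a) (E4.ofTimeSpace 0 (ε • (Y₀ + s • (Y₁ - Y₀))))) :
    segment ℝ ((m₀, (L₀, (ε * a, ε • Y₀))) : ℝ × ((E4 →L[ℝ] E4) × (ℝ × E3)))
        ((m₁, (L₁, (ε * a, ε • Y₁))) : ℝ × ((E4 →L[ℝ] E4) × (ℝ × E3))) ⊆
      {p | |p.1| ≤ Mb ∧ ‖p.2.1‖ ≤ Lb ∧ |p.2.2.1| ≤ ab ∧ ‖p.2.2.2‖ ≤ Rb ∧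
        rb ≤ Kerr.radius p.2.2.1 (E4.ofTimeSpace 0 p.2.2.2)} := by
  rintro _ ⟨s', s, hs1, hs0, hab, rfl⟩
  obtain rfl : s' = 1 - s := by linarith
  have hs : s ∈ Icc (0 : ℝ) 1 := ⟨hs0, by linarith⟩
  have hpos : ε • Y₀ + s • (ε • Y₁ - ε • Y₀) = ε • (Y₀ + s • (Y₁ - Y₀)) := by
    rw [← smul_sub, smul_comm s ε, ← smul_add]
  simp only [mem_setOf_eq, Prod.smul_mk, Prod.mk_add_mk, smul_eq_mul]
  refine ⟨?_, ?_, ?_, ?_, ?_⟩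
  · calc |(1 - s) * m₀ + s * m₁| ≤ |(1 - s) * m₀| + |s * m₁| := abs_add_le _ _
      _ = (1 - s) * |m₀| + s * |m₁| := by rw [abs_mul, abs_mul, abs_of_nonneg hs1, abs_of_nonneg hs0]
      _ ≤ (1 - s) * Mb + s * Mb := add_le_add (mul_le_mul_of_nonneg_left hm₀ hs1)
          (mul_le_mul_of_nonneg_left hm₁ hs0)
      _ = Mb := by ring
  · calc ‖(1 - s) • L₀ + s • L₁‖ ≤ ‖(1 - s) • L₀‖ + ‖s • L₁‖ := norm_add_le _ _
      _ = (1 - s) * ‖L₀‖ + s * ‖L₁‖ := by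
          rw [norm_smul, norm_smul, Real.norm_eq_abs, Real.norm_eq_abs, abs_of_nonneg hs1,
            abs_of_nonneg hs0]
      _ ≤ (1 - s) * Lb + s * Lb := add_le_add (mul_le_mul_of_nonneg_left hL₀ hs1)
          (mul_le_mul_of_nonneg_left hL₁ hs0)
      _ = Lb := by ring
  · rw [show (1 - s) * (ε * a) + s * (ε * a) = ε * a by ring]; exact ha
  · rw [show (1 - s) • (ε • Y₀) + s • (ε • Y₁) = ε • Y₀ + s • (ε • Y₁ - ε • Y₀) by module, hpos]
    exact (hw s hs).1
  · rw [show (1 - s) * (ε * a) + s * (ε * a) = ε * a by ring,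
      show (1 - s) • (ε • Y₀) + s • (ε • Y₁) = ε • Y₀ + s • (ε • Y₁ - ε • Y₀) by module, hpos]
    exact (hw s hs).2

/-- Size bookkeeping for the instantaneous map: `(C/U²)(q + m + 1 + A) ≤ (C/c²)(3 + A)` for
`0 ≤ q, m ≤ t`, `c t ≤ U`, `t ≥ 1`. [folklore] -/
theorem param_size_le {C c t U q m A : ℝ} (hC : 0 ≤ C) (hc : 0 < c) (ht : 1 ≤ t) (hU : c * t ≤ U)
    (hq0 : 0 ≤ q) (hq : q ≤ t) (hm0 : 0 ≤ m) (hm : m ≤ t) (hA : 0 ≤ A) :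
    C / U ^ 2 * (q + m + 1 + A) ≤ C / c ^ 2 * (3 + A) := by
  have ht0 : 0 < t := by linarith
  have hct : 0 < c * t := by positivity
  have hη : C / U ^ 2 ≤ C / c ^ 2 * (1 / t) * (1 / t) := by
    rw [show C / c ^ 2 * (1 / t) * (1 / t) = C / (c * t) ^ 2 by field_simp]
    exact div_le_div_of_nonneg_left hC (by positivity) (pow_le_pow_left₀ hct.le hU 2)
  calc C / U ^ 2 * (q + m + 1 + A) ≤ C / c ^ 2 * (1 / t) * (1 / t) * ((3 + A) * t) :=
        mul_le_mul hη (by nlinarith) (by positivity) (by positivity)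
    _ = C / c ^ 2 * (3 + A) * (1 / t) := by field_simp
    _ ≤ C / c ^ 2 * (3 + A) * 1 := by
        refine mul_le_mul_of_nonneg_left ?_ (by positivity)
        rw [div_le_one ht0]; exact ht
    _ = _ := mul_one _

section Tame

variable {M a rin : ℝ} {Mf : ℝ → ℝ} {Λ : ℝ → lorentzGroup} {ξ : ℝ → E3} {Uc ρ : E4 → ℝ}
  {v A σ γ κ τ₀ : ℝ}

-- the operator-norm instance paths on the parameter space are slow to unify
set_option maxHeartbeats 400000 in
/-- **The tame-regime bound** (see the module docstring). The weighted decay of conclusion (O4) and the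
near-hole part of (O3) of the stub follow from it; the positivity of the retarded rest-frame radius is
conclusion (O2). [cite: KerrSchild1965, §3] -/
theorem tame_pointwise (hsub : Kerr.IsSubextremal M a ∧ Kerr.rMinus M a < rin ∧ rin < Kerr.rPlus M a)
    (hsm : ContDiff ℝ ∞ ξ ∧ ContDiff ℝ ∞ (fun t ↦ ((Λ t : E4 ≃L[ℝ] E4) : E4 →L[ℝ] E4)) ∧ ContDiff ℝ ∞ Mf)
    (hvel : 0 ≤ v ∧ v < 1 ∧ ∀ u, ‖deriv ξ u‖ ≤ v)
    (hal : ∀ u, (Λ u : E4 ≃L[ℝ] E4) (E4.basisVector 0) =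
      ((Λ u : E4 ≃L[ℝ] E4) (E4.basisVector 0)) 0 • E4.ofTimeSpace 1 (deriv ξ u) ∧
      1 ≤ ((Λ u : E4 ≃L[ℝ] E4) (E4.basisVector 0)) 0 ∧ ((Λ u : E4 ≃L[ℝ] E4) (E4.basisVector 0)) 0 ≤ γ)
    (hgl : ∀ u, (∀ k, 1 ≤ k → k ≤ 5 → ‖iteratedDeriv k ξ u‖ ≤ A) ∧
      ∀ k ≤ 4, ‖iteratedDeriv k (fun t ↦ ((Λ t : E4 ≃L[ℝ] E4) : E4 →L[ℝ] E4)) u‖ ≤ A ∧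
        |iteratedDeriv k Mf u| ≤ A)
    (htame : 0 < τ₀ ∧ 0 < σ ∧ ∀ u, τ₀ ≤ u →
      (∀ k, 2 ≤ k → k ≤ 5 → u ^ 2 * ‖iteratedDeriv k ξ u‖ ≤ A) ∧
      (∀ k, 1 ≤ k → k ≤ 4 → u ^ 2 * ‖iteratedDeriv k (fun t ↦ ((Λ t : E4 ≃L[ℝ] E4) : E4 →L[ℝ] E4)) u‖ ≤ A) ∧
      ∀ k ≤ 4, u ^ ((3 : ℝ) / 4 + σ) * |iteratedDeriv k (fun s ↦ Mf s - M) u| ≤ A)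
    (hcone : 0 < κ ∧ κ < 1 ∧ ∀ᶠ t in atTop, ‖ξ t‖ ≤ κ ^ 2 * t)
    (hclock : ∀ x, x 0 - Uc x = ‖E4.spatial x - ξ (Uc x)‖)
    (hU : ContDiffOn ℝ ∞ Uc {x : E4 | E4.spatial x ≠ ξ (Uc x)})
    (hρ : ∀ x, ρ x = Kerr.radius a (poincareInv (Λ (x 0)) (E4.ofTimeSpace (x 0) (ξ (x 0))) x)) :
    ∃ K T : ℝ, 0 ≤ K ∧ 0 < T ∧ ∀ x : E4, T ≤ x 0 → (1 - κ) / 2 * x 0 ≤ Uc x →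
      ‖E4.spatial x - ξ (x 0)‖ ≤ 2 * x 0 → rin < ρ x →
      0 < Kerr.radius a ((Λ (Uc x) : E4 ≃L[ℝ] E4).symm (x - E4.ofTimeSpace (Uc x) (ξ (Uc x)))) ∧
      ∀ m ≤ 3, ‖iteratedFDeriv ℝ m (fun y ↦
          boostedKerrBilin (Λ (Uc y)) (E4.ofTimeSpace (Uc y) (ξ (Uc y))) (Mf (Uc y)) a y -
          boostedKerrBilin (Λ (y 0)) (E4.ofTimeSpace (y 0) (ξ (y 0))) M a y) x‖ ≤
        K * (max 1 ‖E4.spatial x - ξ (x 0)‖)⁻¹ *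
          (1 / x 0 + 1 / ((1 - κ) / 2 * x 0) ^ ((3 : ℝ) / 4 + σ)) := by
  -- constants
  have hM : 0 < M := hsub.1.pos
  have hrin : 0 < rin := rin_pos hsub
  have hA0 : 0 ≤ A := A_nonneg hgl
  have hγ1 : 1 ≤ γ := one_le_gamma hal
  have hγ0 : 0 ≤ γ := zero_le_one.trans hγ1
  have h1v : 0 < 1 - v := by linarith only [hvel.2.1]
  have h1v' : 0 < 1 + v := by linarith only [hvel.1]
  have hτ₀ : 0 < τ₀ := htame.1
  have hσ : 0 < σ := htame.2.1
  obtain ⟨Cθ, hCθ0, hCθ⟩ := exists_norm_iteratedDeriv_theta_le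
  have hCθΛ := hCθ Λ hsm.2.1
  have hCA : 0 ≤ Cθ * A := mul_nonneg hCθ0 hA0
  obtain ⟨T₁, hT₁⟩ := eventually_atTop.mp hcone.2.2
  set T₀ : ℝ := max T₁ 0 with hT₀
  have hκ2 : κ ^ 2 ≤ 1 := by nlinarith only [hcone.1, hcone.2.1]
  have hξs : ∀ s, T₀ ≤ s → ‖ξ s‖ ≤ s := fun s hs ↦ by
    have h0 : 0 ≤ s := (le_max_right _ _).trans hs
    exact (hT₁ s ((le_max_left _ _).trans hs)).trans (by nlinarith only [hκ2, h0])
  set r : ℝ := rin / ((1 + 3 * γ) * (1 + v)) with hr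
  have hr0 : 0 < r := by positivity
  obtain ⟨DU, hDU1, hDU⟩ := exists_clock_deriv_bound hsm.1 hvel.1 hvel.2.1 hvel.2.2
    (fun u k hk1 hk ↦ (hgl u).1 k hk1 (by omega)) hclock hU hr0
  set c : ℝ := (1 - κ) / 2 with hc
  have hc0 : 0 < c := by rw [hc]; linarith only [hcone.2.1]
  set dmin : ℝ := rin / (1 + 3 * γ) with hdmin
  have hdmin0 : 0 < dmin := by positivity
  obtain ⟨ϑ₀, rb, Rb, hϑ₀0, hϑ₀1, hrb0, hbox⟩ := exists_box_segment a hrin hγ0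
  obtain ⟨B, hB0, hB⟩ := exists_ck_kernel 4 (M + A) (1 + 3 * γ) |a| Rb hrb0
  set X₁ : ℝ := 4 * (Cθ * A / c ^ 2) with hX₁
  set X₂ : ℝ := Cθ * A / c ^ 2 * (3 + A) with hX₂
  set Dp₁ : ℝ := max (6 * A * DU ^ 3) (max (6 * (Cθ * A) * DU ^ 3)
    (max 0 (6 * DU ^ 3 * X₁ + 8 * ((1 + 3 * γ) + 6 * (Cθ * A) * DU ^ 3) + 24 * X₂ * DU ^ 3))) with hDp₁
  set Dp₀ : ℝ := max 0 (max (6 * (Cθ * A)) (max 0 (6 * X₁ + 8 * ((1 + 3 * γ) + 6 * (Cθ * A)) + 24 * X₂)))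
    with hDp₀
  set Dp : ℝ := max 1 (max Dp₁ Dp₀) with hDp
  have hDp1 : 1 ≤ Dp := le_max_left _ _
  obtain ⟨Kd, hKd0, hKd⟩ := exists_norm_iteratedFDeriv_comp_sub_comp_le (E := E4)
    (P := ℝ × ((E4 →L[ℝ] E4) × (ℝ × E3))) 3 B Dp
  set Θ₁ : ℝ := Cθ * A / c ^ 2 * (16 + 4 * A) * (1 / (1 - v) + 12 * DU ^ 3 / dmin) with hΘ₁
  have hΘ₁0 : 0 ≤ Θ₁ := by positivity
  set Ql : ℝ := 6 * A * DU ^ 3 + (Cθ * A / c ^ 2 * (2 / (1 - v) + 12 * DU ^ 3) +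
    Cθ * A / c ^ 2 * (1 / (1 - v) + 12 * DU ^ 3) * (12 + 4 * (3 + A))) with hQl
  have hQl0 : 0 ≤ Ql := by positivity
  set T : ℝ := max 1 (max (max τ₀ (max T₀ 1) / c) (Θ₁ / ϑ₀ + 1)) with hT
  refine ⟨Kd * Ql, T, by positivity, lt_max_of_lt_left one_pos, fun x hxT hxU hxd hxρ ↦ ?_⟩
  -- the point
  set t : ℝ := x 0 with ht
  set d : ℝ := ‖E4.spatial x - ξ (x 0)‖ with hd_def
  have ht1 : 1 ≤ t := (le_max_left _ _).trans hxT
  have ht0 : 0 < t := by linarith only [ht1]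
  have hct : max τ₀ (max T₀ 1) ≤ c * t := by
    have h := ((le_max_left _ _).trans (le_max_right _ _)).trans hxT
    rw [div_le_iff₀ hc0] at h
    linarith only [h, mul_comm c t]
  have hUτ : τ₀ ≤ Uc x := ((le_max_left _ _).trans hct).trans hxU
  have hUT₀ : T₀ ≤ Uc x := (((le_max_left _ _).trans (le_max_right _ _)).trans hct).trans hxU
  have hU1 : 1 ≤ Uc x := (((le_max_right _ _).trans (le_max_right _ _)).trans hct).trans hxU
  have hU0 : 0 ≤ Uc x := by linarith only [hU1]
  have hΔ0 := retardation_nonneg hclock x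
  have hUt : Uc x ≤ t := by rw [ht]; linarith only [hΔ0]
  have hΔ1 : (1 - v) * (x 0 - Uc x) ≤ d := retardation_le_dist hsm.1 hvel.1 hvel.2.2 hclock x
  have hdlow : rin < (1 + 3 * γ) * d := dist_lower hal hρ hxρ
  have hdmin_le : dmin ≤ d := by
    rw [hdmin, div_le_iff₀ (by positivity)]; linarith only [hdlow, mul_comm (1 + 3 * γ) d]
  have hd0 : 0 < d := hdmin0.trans_le hdmin_le
  have hΔr : r ≤ x 0 - Uc x := by
    have h := retardation_lower hsm.1 hvel hal hclock hρ hxρ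
    rw [hr, div_le_iff₀ (by positivity)]
    linarith only [h, mul_comm ((1 + 3 * γ) * (1 + v)) (x 0 - Uc x)]
  have hUx := hDU x hΔr
  have hξt : ‖ξ t‖ ≤ t := hξs t (hUT₀.trans hUt)
  have hξI : ∀ s ∈ Icc (Uc x) (x 0), ‖ξ s‖ ≤ s := fun s hs ↦ hξs s (hUT₀.trans hs.1)
  have hxn : ‖x‖ ≤ 4 * t := by
    have h := norm_point_le x (ξ (x 0))
    rw [abs_of_pos ht0] at h
    have hd2 : d ≤ 2 * t := hxd
    linarith only [h, hd2, hξt]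
  set ε : ℝ := (max 1 d)⁻¹ with hε
  have hm1 : 1 ≤ max 1 d := le_max_left _ _
  have hε0 : 0 < ε := inv_pos.mpr (by linarith only [hm1])
  have hε1 : ε ≤ 1 := inv_le_one_of_one_le₀ hm1
  -- sizes of the parameter maps
  obtain ⟨hsz₁, hsz₂⟩ := tame_param_sizes (C := Cθ * A) (A := A) hCA hc0 ht1 hxU hUt (norm_nonneg x) hxn
    (norm_nonneg _) ((hξs (Uc x) hUT₀).trans hUt) hA0
  have hsz₃ := param_size_le (C := Cθ * A) (q := |x 0|) (m := ‖ξ (x 0)‖) hCA hc0 ht1 hxU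
    (abs_nonneg _) (by rw [abs_of_pos ht0]) (norm_nonneg _) hξt hA0
  have hp₁ := tame_ck₁_ret (a := a) hsm hal hgl hCθ0 hCθΛ hτ₀ (fun u hu ↦ (htame.2.2 u hu).2.1) hDU1 hUx
    hUτ hU1 hε0 hε1 hsz₁ hsz₂
  have hp₀ := tame_ck₁_inst (M := M) (a := a) hsm hal hgl hCθ0 hCθΛ hτ₀ (fun u hu ↦ (htame.2.2 u hu).2.1)
    (x := x) hUτ hU1 hUt hε0 hε1 hsz₁ hsz₃
  have hp₁' := ck₁_mono hp₁ le_rfl ((le_max_left _ _).trans (le_max_right 1 (max Dp₁ Dp₀)))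
  have hp₀' := ck₁_mono hp₀ le_rfl ((le_max_right _ _).trans (le_max_right 1 (max Dp₁ Dp₀)))
  -- the parameter difference
  have hδ := tame_ck_delta (a := a) hsm hal hgl hCθ0 hCθΛ hτ₀ (fun u hu ↦ (htame.2.2 u hu).2.1)
    (fun u hu ↦ (htame.2.2 u hu).2.2) hDU1 hUx hUτ hUt hξI hε0
  -- the rest-frame positions and the box
  have hY₀ := norm_restPosition_inst (Λ := Λ (x 0)) (x := x) (t := x 0) rfl (ξ (x 0)) (hal (x 0)).2.1
    (hal (x 0)).2.2
  have hρY₀ : rin < Kerr.radius a (E4.ofTimeSpace 0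
      (E4.spatial ((Λ (x 0) : E4 ≃L[ℝ] E4).symm (x - E4.ofTimeSpace (x 0) (ξ (x 0)))))) := by
    rw [← rho_eq hρ]; exact hxρ
  -- relative smallness of the position defect
  have hδθ := tame_ck_thetaDefect hsm.2.1 hCθ0 hCθΛ hτ₀ hA0 (fun u hu ↦ (htame.2.2 u hu).2.1) hDU1 hUx
    hUτ hUt
  have hδb := tame_ck_offsetDefect hsm hal hgl hCθ0 hCθΛ hτ₀ (fun u hu ↦ (htame.2.2 u hu).2.1) hDU1 hUx
    hUτ hUt hξI
  have hrel : ‖E4.spatial ((Λ (Uc x) : E4 ≃L[ℝ] E4).symm (x - E4.ofTimeSpace (Uc x) (ξ (Uc x)))) -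
      E4.spatial ((Λ (x 0) : E4 ≃L[ℝ] E4).symm (x - E4.ofTimeSpace (x 0) (ξ (x 0))))‖ ≤ ϑ₀ * d := by
    have e : E4.spatial ((Λ (Uc x) : E4 ≃L[ℝ] E4).symm (x - E4.ofTimeSpace (Uc x) (ξ (Uc x)))) -
        E4.spatial ((Λ (x 0) : E4 ≃L[ℝ] E4).symm (x - E4.ofTimeSpace (x 0) (ξ (x 0)))) =
        E4.spatial (((((Λ (Uc x) : E4 ≃L[ℝ] E4).symm : E4 ≃L[ℝ] E4) : E4 →L[ℝ] E4) -
          (((Λ (x 0) : E4 ≃L[ℝ] E4).symm : E4 ≃L[ℝ] E4) : E4 →L[ℝ] E4)) x) -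
        (E4.spatial ((Λ (Uc x) : E4 ≃L[ℝ] E4).symm (E4.ofTimeSpace (Uc x) (ξ (Uc x)))) -
          E4.spatial ((Λ (x 0) : E4 ≃L[ℝ] E4).symm (E4.ofTimeSpace (x 0) (ξ (x 0))))) := by
      simp only [map_sub, FunLike.coe_sub, Pi.sub_apply, ContinuousLinearEquiv.coe_coe]
      abel
    rw [e]
    have h1 := hδθ.2 0 (Nat.zero_le _)
    have h2 := hδb.2 0 (Nat.zero_le _)
    rw [norm_iteratedFDeriv_zero] at h1 h2
    refine (norm_sub_le _ _).trans ?_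
    have h3 : ‖E4.spatial (((((Λ (Uc x) : E4 ≃L[ℝ] E4).symm : E4 ≃L[ℝ] E4) : E4 →L[ℝ] E4) -
        (((Λ (x 0) : E4 ≃L[ℝ] E4).symm : E4 ≃L[ℝ] E4) : E4 →L[ℝ] E4)) x)‖ ≤
        Cθ * A / Uc x ^ 2 * ((x 0 - Uc x) + 12 * DU ^ 3) * ‖x‖ :=
      ((E4.spatial.le_opNorm _).trans (mul_le_of_le_one_left (norm_nonneg _) norm_spatial_le)).trans
        ((ContinuousLinearMap.le_opNorm _ _).trans (mul_le_mul_of_nonneg_right h1 (norm_nonneg _)))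
    have h4 := tame_relative (C := Cθ * A) (n := ‖x‖) hCA hc0 hvel.2.1 hDU1 ht1 hxU hΔ0 hΔ1 (norm_nonneg x)
      hxn hA0 hdmin0 hdmin_le
    have h5 : Θ₁ * (1 / t) ≤ ϑ₀ := by
      have hT' : Θ₁ / ϑ₀ + 1 ≤ t := ((le_max_right _ _).trans (le_max_right _ _)).trans hxT
      rw [mul_one_div, div_le_iff₀ ht0]
      rw [div_add_one hϑ₀0.ne', div_le_iff₀ hϑ₀0] at hT'
      nlinarith only [hT', hΘ₁0, hϑ₀0]
    calc _ ≤ Cθ * A / Uc x ^ 2 * ((x 0 - Uc x) + 12 * DU ^ 3) * ‖x‖ +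
          4 * (Cθ * A / Uc x ^ 2) * (2 * x 0 + 1 + A) * ((x 0 - Uc x) + 12 * DU ^ 3) := add_le_add h3 h2
      _ = Cθ * A / Uc x ^ 2 * ((x 0 - Uc x) + 12 * DU ^ 3) * (‖x‖ + 4 * (2 * t + 1 + A)) := by
          rw [ht]; ring
      _ ≤ Θ₁ * (1 / t) * d := h4
      _ ≤ ϑ₀ * d := mul_le_mul_of_nonneg_right h5 hd0.le
  have hseg := hbox _ _ d hd0.le hY₀.1 hY₀.2 hρY₀ hrel
  -- (O2): the retarded rest-frame radius is positive
  have hpos : 0 < Kerr.radius a ((Λ (Uc x) : E4 ≃L[ℝ] E4).symm (x - E4.ofTimeSpace (Uc x) (ξ (Uc x)))) := by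
    have h := (hseg 1 (right_mem_Icc.mpr zero_le_one)).2
    rw [one_smul, add_sub_cancel, radius_slice_smul hε0] at h
    have h2 : 0 < Kerr.radius a (E4.ofTimeSpace 0
        (E4.spatial ((Λ (Uc x) : E4 ≃L[ℝ] E4).symm (x - E4.ofTimeSpace (Uc x) (ξ (Uc x)))))) := by
      by_contra hneg
      rw [not_lt] at hneg
      have : ε * Kerr.radius a (E4.ofTimeSpace 0 (E4.spatial ((Λ (Uc x) : E4 ≃L[ℝ] E4).symm
          (x - E4.ofTimeSpace (Uc x) (ξ (Uc x)))))) ≤ 0 := mul_nonpos_of_nonneg_of_nonpos hε0.le hneg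
      linarith only [this, h, hrb0]
    rwa [Kerr.radius_eq_of_spatial_eq a (E4.spatial_ofTimeSpace 0 _)] at h2
  refine ⟨hpos, fun m hm ↦ ?_⟩
  -- the segment of parameters lies in the box
  have hV := segment_subset_box (m₀ := M) (m₁ := Mf (Uc x)) (a := a) (ε := ε)
    (L₀ := (((Λ (x 0) : E4 ≃L[ℝ] E4).symm : E4 ≃L[ℝ] E4) : E4 →L[ℝ] E4))
    (L₁ := (((Λ (Uc x) : E4 ≃L[ℝ] E4).symm : E4 ≃L[ℝ] E4) : E4 →L[ℝ] E4))
    (Mb := M + A) (Lb := 1 + 3 * γ) (ab := |a|) (Rb := Rb) (rb := rb)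
    (by rw [abs_of_pos hM]; linarith only [hA0])
    ((abs_mass_le hgl (Uc x)).trans (by linarith only [hM]))
    (norm_theta_le (hal (x 0)).2.1 (hal (x 0)).2.2) (norm_theta_le (hal (Uc x)).2.1 (hal (Uc x)).2.2)
    (by rw [abs_mul, abs_of_pos hε0]; exact mul_le_of_le_one_left (abs_nonneg a) hε1) hseg
  obtain ⟨hO, hF4⟩ := contDiffOn_kernel (n := 4)
  have hVO : {p : ℝ × ((E4 →L[ℝ] E4) × (ℝ × E3)) | |p.1| ≤ M + A ∧ ‖p.2.1‖ ≤ 1 + 3 * γ ∧ |p.2.2.1| ≤ |a| ∧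
      ‖p.2.2.2‖ ≤ Rb ∧ rb ≤ Kerr.radius p.2.2.1 (E4.ofTimeSpace 0 p.2.2.2)} ⊆
      {p | 0 < Kerr.radius p.2.2.1 (E4.ofTimeSpace 0 p.2.2.2)} := fun p hp ↦ hrb0.trans_le hp.2.2.2.2
  have hBV : ∀ q ∈ {p : ℝ × ((E4 →L[ℝ] E4) × (ℝ × E3)) | |p.1| ≤ M + A ∧ ‖p.2.1‖ ≤ 1 + 3 * γ ∧
      |p.2.2.1| ≤ |a| ∧ ‖p.2.2.2‖ ≤ Rb ∧ rb ≤ Kerr.radius p.2.2.1 (E4.ofTimeSpace 0 p.2.2.2)},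
      ∀ i, 1 ≤ i → i ≤ 3 + 1 → ‖iteratedFDeriv ℝ i (fun p : ℝ × ((E4 →L[ℝ] E4) × (ℝ × E3)) ↦
        (Kerr.bilin p.1 p.2.2.1 (E4.ofTimeSpace 0 p.2.2.2) - Minkowski.bilin).bilinearComp p.2.1 p.2.1) q‖
        ≤ B := fun q hq i _ hi ↦ (hB q hq.1 hq.2.1 hq.2.2.1 hq.2.2.2.1 hq.2.2.2.2).2 i hi
  have hdiff := hKd (F := E4 →L[ℝ] E4 →L[ℝ] ℝ) hO hVO hF4 hBV hV hp₀' hp₁' hDp1 hδ.2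
  -- the two endpoints are in the box: smoothness of the two compositions
  have hq₀ := hV (left_mem_segment ℝ _ _)
  have hq₁ := hV (right_mem_segment ℝ _ _)
  have hK₀ := ck_mono (hB _ hq₀.1 hq₀.2.1 hq₀.2.2.1 hq₀.2.2.2.1 hq₀.2.2.2.2) (show 3 ≤ 4 by norm_num) le_rfl
  have hK₁ := ck_mono (hB _ hq₁.1 hq₁.2.1 hq₁.2.2.1 hq₁.2.2.2.1 hq₁.2.2.2.2) (show 3 ≤ 4 by norm_num) le_rfl
  have hc₀ := (ck_comp
    (g := fun p : ℝ × ((E4 →L[ℝ] E4) × (ℝ × E3)) ↦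
      (Kerr.bilin p.1 p.2.2.1 (E4.ofTimeSpace 0 p.2.2.2) - Minkowski.bilin).bilinearComp p.2.1 p.2.1)
    (f := fun y ↦ ((M, ((((Λ (y 0) : E4 ≃L[ℝ] E4).symm : E4 ≃L[ℝ] E4) : E4 →L[ℝ] E4),
        (ε * a, ε • E4.spatial ((Λ (y 0) : E4 ≃L[ℝ] E4).symm (y - E4.ofTimeSpace (y 0) (ξ (y 0))))))) :
        ℝ × ((E4 →L[ℝ] E4) × (ℝ × E3)))) (x := x) hK₀ hp₀').1
  have hc₁ := (ck_comp
    (g := fun p : ℝ × ((E4 →L[ℝ] E4) × (ℝ × E3)) ↦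
      (Kerr.bilin p.1 p.2.2.1 (E4.ofTimeSpace 0 p.2.2.2) - Minkowski.bilin).bilinearComp p.2.1 p.2.1)
    (f := fun y ↦ ((Mf (Uc y), ((((Λ (Uc y) : E4 ≃L[ℝ] E4).symm : E4 ≃L[ℝ] E4) : E4 →L[ℝ] E4),
        (ε * a, ε • E4.spatial ((Λ (Uc y) : E4 ≃L[ℝ] E4).symm (y - E4.ofTimeSpace (Uc y) (ξ (Uc y))))))) :
        ℝ × ((E4 →L[ℝ] E4) × (ℝ × E3)))) (x := x) hK₁ hp₁').1
  -- the kernel identity for the difference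
  have hid : (fun y ↦ boostedKerrBilin (Λ (Uc y)) (E4.ofTimeSpace (Uc y) (ξ (Uc y))) (Mf (Uc y)) a y -
      boostedKerrBilin (Λ (y 0)) (E4.ofTimeSpace (y 0) (ξ (y 0))) M a y) =
      fun y ↦ ε • ((fun p : ℝ × ((E4 →L[ℝ] E4) × (ℝ × E3)) ↦
        (Kerr.bilin p.1 p.2.2.1 (E4.ofTimeSpace 0 p.2.2.2) - Minkowski.bilin).bilinearComp p.2.1 p.2.1)
        ((Mf (Uc y), ((((Λ (Uc y) : E4 ≃L[ℝ] E4).symm : E4 ≃L[ℝ] E4) : E4 →L[ℝ] E4),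
          (ε * a, ε • E4.spatial ((Λ (Uc y) : E4 ≃L[ℝ] E4).symm (y - E4.ofTimeSpace (Uc y) (ξ (Uc y))))))) :
          ℝ × ((E4 →L[ℝ] E4) × (ℝ × E3))) -
        (fun p : ℝ × ((E4 →L[ℝ] E4) × (ℝ × E3)) ↦
        (Kerr.bilin p.1 p.2.2.1 (E4.ofTimeSpace 0 p.2.2.2) - Minkowski.bilin).bilinearComp p.2.1 p.2.1)
        ((M, ((((Λ (y 0) : E4 ≃L[ℝ] E4).symm : E4 ≃L[ℝ] E4) : E4 →L[ℝ] E4),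
          (ε * a, ε • E4.spatial ((Λ (y 0) : E4 ≃L[ℝ] E4).symm (y - E4.ofTimeSpace (y 0) (ξ (y 0))))))) :
          ℝ × ((E4 →L[ℝ] E4) × (ℝ × E3)))) := by
    funext y
    have h1 := boostedKerrBilin_sub_eq_smul_kernel (Λ (Uc y)) (E4.ofTimeSpace (Uc y) (ξ (Uc y))) (Mf (Uc y))
      a hε0 y
    have h0 := boostedKerrBilin_sub_eq_smul_kernel (Λ (y 0)) (E4.ofTimeSpace (y 0) (ξ (y 0))) M a hε0 y
    rw [smul_sub, ← h1, ← h0, sub_sub_sub_cancel_right]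
  -- the bound
  rw [hid]
  have hsm3 := ck_const_smul (n := 3) ⟨hc₁.sub hc₀, hdiff⟩ ε
  refine (hsm3.2 m hm).trans ?_
  rw [abs_of_pos hε0]
  have hrate : max (6 * (A / Uc x ^ ((3 : ℝ) / 4 + σ)) * DU ^ 3)
      (max (Cθ * A / Uc x ^ 2 * ((x 0 - Uc x) + 12 * DU ^ 3))
        (max ‖(0 : ℝ)‖ (ε * (Cθ * A / Uc x ^ 2 * ((x 0 - Uc x) + 12 * DU ^ 3) * ‖x‖ +
          8 * (Cθ * A / Uc x ^ 2 * ((x 0 - Uc x) + 12 * DU ^ 3)) +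
          4 * (Cθ * A / Uc x ^ 2) * (2 * x 0 + 1 + A) * ((x 0 - Uc x) + 12 * DU ^ 3))))) ≤
      Ql * (1 / t + 1 / (c * t) ^ ((3 : ℝ) / 4 + σ)) := by
    obtain ⟨hr₁, hr₂⟩ := tame_rates (C := Cθ * A) (A := A) (n := ‖x‖) hCA hc0 hvel.2.1 hDU1 ht1 hxU hΔ0
      hΔ1 hxd (norm_nonneg x) hxn hA0
    have hctp : 0 < c * t := by positivity
    have hmass := mass_rate_le (σ := σ) hA0 hctp hxU hσ
    have hR₁ : 0 ≤ 1 / t := by positivity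
    have hR₂ : 0 ≤ 1 / (c * t) ^ ((3 : ℝ) / 4 + σ) := by positivity
    have e1 : 6 * (A / Uc x ^ ((3 : ℝ) / 4 + σ)) * DU ^ 3 ≤ 6 * A * DU ^ 3 * (1 / (c * t) ^ ((3 : ℝ) / 4 + σ)) := by
      calc 6 * (A / Uc x ^ ((3 : ℝ) / 4 + σ)) * DU ^ 3 ≤ 6 * (A / (c * t) ^ ((3 : ℝ) / 4 + σ)) * DU ^ 3 := by
            gcongr
        _ = _ := by ring
    have hQ₁ : 6 * A * DU ^ 3 ≤ Ql := by
      rw [hQl]; linarith only [show (0:ℝ) ≤ Cθ * A / c ^ 2 * (2 / (1 - v) + 12 * DU ^ 3) +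
        Cθ * A / c ^ 2 * (1 / (1 - v) + 12 * DU ^ 3) * (12 + 4 * (3 + A)) by positivity]
    have hQ₂ : Cθ * A / c ^ 2 * (2 / (1 - v) + 12 * DU ^ 3) +
        Cθ * A / c ^ 2 * (1 / (1 - v) + 12 * DU ^ 3) * (12 + 4 * (3 + A)) ≤ Ql := by
      rw [hQl]; linarith only [show (0:ℝ) ≤ 6 * A * DU ^ 3 by positivity]
    rw [norm_zero]
    refine max_le ?_ (max_le ?_ (max_le ?_ ?_))
    · calc _ ≤ 6 * A * DU ^ 3 * (1 / (c * t) ^ ((3 : ℝ) / 4 + σ)) := e1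
        _ ≤ Ql * (1 / (c * t) ^ ((3 : ℝ) / 4 + σ)) := mul_le_mul_of_nonneg_right hQ₁ hR₂
        _ ≤ _ := by nlinarith only [hQl0, hR₁, hR₂]
    · calc _ ≤ Cθ * A / c ^ 2 * (2 / (1 - v) + 12 * DU ^ 3) * (1 / t) := hr₁
        _ ≤ Ql * (1 / t) := by
            refine mul_le_mul_of_nonneg_right ?_ hR₁
            linarith only [hQ₂, show (0:ℝ) ≤ Cθ * A / c ^ 2 * (1 / (1 - v) + 12 * DU ^ 3) *
              (12 + 4 * (3 + A)) by positivity]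
        _ ≤ _ := by nlinarith only [hQl0, hR₁, hR₂]
    · nlinarith only [hQl0, hR₁, hR₂]
    · calc _ ≤ Cθ * A / c ^ 2 * (1 / (1 - v) + 12 * DU ^ 3) * (12 + 4 * (3 + A)) * (1 / t) := hr₂
        _ ≤ Ql * (1 / t) := by
            refine mul_le_mul_of_nonneg_right ?_ hR₁
            linarith only [hQ₂, show (0:ℝ) ≤ Cθ * A / c ^ 2 * (2 / (1 - v) + 12 * DU ^ 3) by positivity]
        _ ≤ _ := by nlinarith only [hQl0, hR₁, hR₂]
  calc ε * (Kd * _) ≤ ε * (Kd * (Ql * (1 / t + 1 / (c * t) ^ ((3 : ℝ) / 4 + σ)))) :=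
        mul_le_mul_of_nonneg_left (mul_le_mul_of_nonneg_left hrate hKd0) hε0.le
    _ = Kd * Ql * ε * (1 / t + 1 / (c * t) ^ ((3 : ℝ) / 4 + σ)) := by ring

end Tame

end OneHole

/-- Registered sub-goal form (stub `oneHole_param_size_le` of the crux item) of `OneHole.param_size_le`:
size bookkeeping of the instantaneous parameter map in the tame regime. [folklore] -/
theorem oneHole_param_size_le : ∀ {C c t U q m A : ℝ}, 0 ≤ C → 0 < c → 1 ≤ t → c * t ≤ U → 0 ≤ q → q ≤ t → 0 ≤ m → m ≤ t → 0 ≤ A → C / U ^ 2 * (q + m + 1 + A) ≤ C / c ^ 2 * (3 + A) :=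
  fun hC hc ht hU hq0 hq hm0 hm hA ↦ OneHole.param_size_le hC hc ht hU hq0 hq hm0 hm hA

end Summit.FinalStateConjecture.FinalStateConjecture.Theorems

end
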